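/-
Copyright (c) 2026. All rights reserved.
Released under Apache 2.0 license as described in the file LICENSE.
-/
import Literature.NumberTheory.GaloisRepresentations.LabelledTwistRingFiltration
import Literature.NumberTheory.GaloisRepresentations.LabelledWeightsTwistPeriods
import Literature.NumberTheory.GaloisRepresentations.LabelledWeightsRankOneBaseChange
import Literature.NumberTheory.GaloisRepresentations.UnramifiedLabelledWeightsFinite
import Literature.NumberTheory.GaloisRepresentations.LabelledHodgeFiltration
import Literature.NumberTheory.GaloisRepresentations.LabelledWeightsDeRhamRank
import Literature.NumberTheory.GaloisRepresentations.FramedRepTwist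
import Literature.NumberTheory.GaloisRepresentations.PAdicHodgeProofs

/-!
# Labelled Hodge–Tate weights of the determinant: `HT_τ(det ρ) = {Σ HT_τ(ρ)}`

For a period-ring datum `𝔅 = (B, Fil^• B)` of a topological group `Γ` over `F/P` whose period ring
`B` is a field (e.g. `B_dR(K)`), a coefficient field `E/P` finite containing the `[F:P]` embeddings
of `F`, and a framed representation `rE : Γ → GL_n(E)` which is `B`-admissible and satisfies the
filtered comparison (hypothesis `hcomp`, supplied for `B_dR` by the accepted
`exists_basis_mem_filTensor_iff_of_isDeRham`), we prove, for every label `τ : F → E`,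

  `HT_τ(det rE) = {Σ_k HT_τ(rE)_k}`                    (`labelledHodgeTateWeights_scalar_comp_det`)

where `det rE` is the character `g ↦ det rE(g)` viewed as the framed representation
`(scalar E 1) ∘ det rE : Γ → GL_1(E)`.

## Proof

Write `R = E ⊗_P B` (`= (Fin 1 → E) ⊗_P B`, a commutative `E`-algebra) and, for `τ` fixed,
`T = B ⊗_{F,τ} E` (`PeriodRingData.TwistRing`) with its multiplicative filtration
(`LabelledTwistRingFiltration`).  Let `(d_k)_{k<n}` be an `E`-basis of `D_τ(rE)` adapted to the
Hodge filtration, with weights `h_k` (`exists_basis_labelD_adapted`), so `HT_τ(rE) = {h_k}` and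
`Σ HT_τ(rE) = h := Σ_k h_k`.

* The `i`-th coordinate lines `κ_i : Eⁿ ⊗ B → R`, `v ⊗ b ↦ v_i ⊗ b`, give the `n × n` matrix
  `C_R = (κ_i d_k)` over `R` and **the period determinant `δ = det C_R · x_τ ∈ R`**, where
  `1 = Σ_{τ'} x_{τ'}` is the decomposition of `1 ∈ R` along the labels for the TRIVIAL character
  (`exists_sum_labelFilD_eq`; `x_τ ∈ Fil⁰`, `f · x_τ = τ(f) x_τ`, `σ x_τ = x_τ`).
* **Equivariance.**  `Γ` acts on `R` through ring automorphisms `σ_R = 1 ⊗ σ`, and the diagonal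
  action of the character `det rE` is `det rE(σ) · σ_R`.  Invariance of the `d_k` reads
  `C_R = σ_R(C_R) · ᵗ(rE σ)`, so `det C_R = σ_R(det C_R) · det rE(σ)`: `δ` is invariant, and it is a
  `τ`-eigenvector because `x_τ` is (`f · (y y') = y · (f · y')`).  So `δ ∈ D_τ(det rE)`.
* **Filtration degree.**  Rows of `C_R` lie in `Fil^{h_k} R`, so `δ ∈ Fil^h R`.  The ring map
  `p : R → T`, `v ⊗ b ↦ b ⊗ v_0` sends `κ_i(x) ↦ piTwist τ x i`, `x_τ ↦ 1` and `Fil^j R → Fil^j T`;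
  hence `p(δ) = det (piTwist τ d_k)_k`, which is NOT in `Fil^{h+1} T` (`isUnit_det_piTwist_and_mem`):
  `δ ∉ Fil^{h+1} R`, in particular `δ ≠ 0`.
* **Assembly** (`labelledHodgeTateWeights_eq_singleton`).  A nonzero `τ'`-eigenvector in
  `D(det rE)` for every `τ'` and Fontaine's count `dim_E D(det rE) ≤ [F:P]` force
  `dim_E D_{τ'}(det rE) = 1`; the filtration of the line `D_τ` is read off its generator `δ`
  (`finrank_labelFilD_eq_ite_of_finrank_eq_one`): one jump, at `h`.

The case `n = 0` (trivial character, `δ = x_τ`, `h = 0`) is covered by the same argument.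

## References
* [Patrikis2019] S. Patrikis, *Variations on a theorem of Tate*, Mem. AMS 258 (2019), §2.3.1
  (`D_dR` with coefficients is a `⊗`-functor to filtered `F ⊗ E`-modules; labelled weights of
  `det`), §2.7.1.
* [FontaineAsterisque223III] J.-M. Fontaine, Astérisque 223 (1994), Exp. III §1.5.4, Thm. 1.5.2,
  Prop. 1.5.2 (admissible representations form a tannakian subcategory; `D_B` is a `⊗`-functor).
* [Wach1996] N. Wach, Bull. SMF 124 (1996), §B.2.3, proof of Prop. 2 (p. 394).
* [Lang1965Algebra] S. Lang, *Algebra*, Ch. XIII §4 (determinants), Ch. XVI (tensor products).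
-/

noncomputable section

open scoped TensorProduct
open TensorProduct

namespace Literature.NumberTheory.GaloisRepresentations

namespace PeriodRingData

universe u v v' w w'

-- Mathlib's own global value of `maxSynthPendingDepth` (see `LabelledWeightsTwist`); the tensor
-- types need a higher instance-synthesis budget.
set_option maxSynthPendingDepth 3
set_option synthInstance.maxHeartbeats 200000

/-! ### The coefficient period ring `R = E ⊗_P B` in rank one -/

section RankOneRing

variable {Γ : Type u} [Group Γ] [TopologicalSpace Γ] {P : Type v} {F : Type v'} [Field P] [Field F]
  [Algebra P F] {E : Type w} [Field E] [Algebra P E] [TopologicalSpace E]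
  (𝔅 : PeriodRingData.{u, v, v', w'} Γ P F)

omit [TopologicalSpace Γ] [TopologicalSpace E] in
/-- The `F`-action on `R = E ⊗_P B` is multiplication by `1 ⊗ f`: `f · y = y · (1 ⊗ f)`.
[cite: FontaineAsterisque223III, Exp. III §1.5.4] -/
theorem baseAct_eq_mul_tmul (f : F) (y : (Fin 1 → E) ⊗[P] 𝔅.B) :
    𝔅.baseAct E (Fin 1 → E) f y = y * ((1 : Fin 1 → E) ⊗ₜ[P] algebraMap F 𝔅.B f) := by
  induction y using TensorProduct.induction_on with
  | zero => rw [map_zero, zero_mul]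
  | tmul c b =>
    rw [baseAct_tmul, Algebra.TensorProduct.tmul_mul_tmul, mul_one, Algebra.smul_def, mul_comm]
  | add y z hy hz => rw [map_add, hy, hz, add_mul]

omit [TopologicalSpace Γ] [TopologicalSpace E] in
/-- `f · (y · y') = y · (f · y')` in `R = E ⊗_P B`. [cite: FontaineAsterisque223III, Exp. III §1.5.4] -/
theorem baseAct_mul (f : F) (y y' : (Fin 1 → E) ⊗[P] 𝔅.B) :
    𝔅.baseAct E (Fin 1 → E) f (y * y') = y * 𝔅.baseAct E (Fin 1 → E) f y' := by
  rw [baseAct_eq_mul_tmul, baseAct_eq_mul_tmul, mul_assoc]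

omit [TopologicalSpace Γ] [TopologicalSpace E] in
/-- `1 ∈ E ⊗ Fil⁰ B`. [cite: FontaineAsterisque223III, Exp. III §1.5.4] -/
theorem one_mem_coeffFilTensor_zero :
    (1 : (Fin 1 → E) ⊗[P] 𝔅.B) ∈ 𝔅.coeffFilTensor E (Fin 1 → E) 0 := by
  rw [Algebra.TensorProduct.one_def]
  exact 𝔅.tmul_mem_coeffFilTensor _ 𝔅.one_mem_fil_zero

omit [TopologicalSpace Γ] [TopologicalSpace E] in
/-- A product of elements of `E ⊗ Fil^{i_l} B` lies in `E ⊗ Fil^{Σ i_l} B`.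
[cite: FontaineAsterisque223III, Exp. III §1.5.4] -/
theorem prod_mem_coeffFilTensor {ι : Type*} (s : Finset ι) (x : ι → (Fin 1 → E) ⊗[P] 𝔅.B)
    (i : ι → ℤ) (h : ∀ l ∈ s, x l ∈ 𝔅.coeffFilTensor E (Fin 1 → E) (i l)) :
    ∏ l ∈ s, x l ∈ 𝔅.coeffFilTensor E (Fin 1 → E) (∑ l ∈ s, i l) := by
  classical
  induction s using Finset.induction_on with
  | empty => rw [Finset.prod_empty, Finset.sum_empty]; exact 𝔅.one_mem_coeffFilTensor_zero
  | insert a s ha ih =>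
    rw [Finset.prod_insert ha, Finset.sum_insert ha]
    exact 𝔅.mul_mem_coeffFilTensor E (h a (Finset.mem_insert_self a s))
      (ih fun l hl => h l (Finset.mem_insert_of_mem hl))

omit [TopologicalSpace Γ] [TopologicalSpace E] in
/-- **A determinant over `R = E ⊗_P B` whose `k`-th row lies in `E ⊗ Fil^{i_k} B` lies in
`E ⊗ Fil^{Σ i_k} B`** (Leibniz formula). [cite: Lang1965Algebra, Ch. XIII §4 (expansion of the determinant)] -/
theorem det_mem_coeffFilTensor {m : ℕ} (A : Matrix (Fin m) (Fin m) ((Fin 1 → E) ⊗[P] 𝔅.B))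
    (i : Fin m → ℤ) (hA : ∀ k l, A k l ∈ 𝔅.coeffFilTensor E (Fin 1 → E) (i k)) :
    A.det ∈ 𝔅.coeffFilTensor E (Fin 1 → E) (∑ k, i k) := by
  rw [← Matrix.det_transpose, Matrix.det_apply]
  refine Submodule.sum_mem _ fun σ _ => ?_
  rw [Units.smul_def]
  exact zsmul_mem (𝔅.prod_mem_coeffFilTensor Finset.univ (fun l => A.transpose (σ l) l) i
    fun l _ => hA l (σ l)) _

variable (τ : F →ₐ[P] E)

omit [TopologicalSpace Γ] [TopologicalSpace E] in
/-- **The projection `p_τ : E ⊗_P B → B ⊗_{F,τ} E`, `c ⊗ b ↦ b ⊗ c`, is a ring homomorphism**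
(it is `y ↦ piTwist τ y 0`). [cite: Lang1965Algebra, Ch. XVI §6 (tensor product of algebras)] -/
theorem exists_ringHom_piTwist_one :
    ∃ φ : (Fin 1 → E) ⊗[P] 𝔅.B →+* 𝔅.TwistRing τ, ∀ y, φ y = 𝔅.piTwist τ 1 y 0 := by
  have hmul : ∀ y y' : (Fin 1 → E) ⊗[P] 𝔅.B,
      𝔅.piTwist τ 1 (y * y') 0 = 𝔅.piTwist τ 1 y 0 * 𝔅.piTwist τ 1 y' 0 := by
    intro y y'
    induction y using TensorProduct.induction_on with
    | zero => rw [zero_mul, map_zero, Pi.zero_apply, zero_mul]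
    | tmul v b =>
      induction y' using TensorProduct.induction_on with
      | zero => rw [mul_zero, map_zero, Pi.zero_apply, mul_zero]
      | tmul v' b' =>
        rw [Algebra.TensorProduct.tmul_mul_tmul, piTwist_tmul, piTwist_tmul, piTwist_tmul,
          Algebra.TensorProduct.tmul_mul_tmul, Pi.mul_apply, map_mul]
      | add y₁ y₂ h₁ h₂ =>
        rw [mul_add, map_add, Pi.add_apply, h₁, h₂, map_add, Pi.add_apply, mul_add]
    | add y₁ y₂ h₁ h₂ =>
      rw [add_mul, map_add, Pi.add_apply, h₁, h₂, map_add, Pi.add_apply, add_mul]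
  have hone : 𝔅.piTwist τ 1 (1 : (Fin 1 → E) ⊗[P] 𝔅.B) 0 = 1 := by
    rw [Algebra.TensorProduct.one_def, piTwist_tmul, Pi.one_apply, map_one,
      ← Algebra.TensorProduct.one_def]
  have hzero : 𝔅.piTwist τ 1 (0 : (Fin 1 → E) ⊗[P] 𝔅.B) 0 = 0 := by rw [map_zero, Pi.zero_apply]
  have hadd : ∀ y y' : (Fin 1 → E) ⊗[P] 𝔅.B,
      𝔅.piTwist τ 1 (y + y') 0 = 𝔅.piTwist τ 1 y 0 + 𝔅.piTwist τ 1 y' 0 := fun y y' => by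
    rw [map_add, Pi.add_apply]
  exact ⟨⟨⟨⟨fun y => 𝔅.piTwist τ 1 y 0, hone⟩, hmul⟩, hzero, hadd⟩, fun y => rfl⟩

end RankOneRing

/-! ### Coordinate lines `κ_i : Eⁿ ⊗ B → E ⊗ B` and the `Γ`-actions -/

section Lines

variable {Γ : Type u} [Group Γ] [TopologicalSpace Γ] {P : Type v} {F : Type v'} [Field P] [Field F]
  [Algebra P F] {E : Type w} [Field E] [Algebra P E] [TopologicalSpace E] [IsTopologicalRing E]
  (𝔅 : PeriodRingData.{u, v, v', w'} Γ P F) {n : ℕ}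
  (κ : Fin n → ((Fin n → E) ⊗[P] 𝔅.B →ₗ[E] (Fin 1 → E) ⊗[P] 𝔅.B))
  (hκ : ∀ (j : Fin n) (v : Fin n → E) (b : 𝔅.B), κ j (v ⊗ₜ[P] b) = (fun _ : Fin 1 => v j) ⊗ₜ[P] b)

omit [TopologicalSpace Γ] [TopologicalSpace E] [IsTopologicalRing E] in
include hκ in
/-- `κ_i(Eⁿ ⊗ Fil^j B) ⊆ E ⊗ Fil^j B`. [cite: FontaineAsterisque223III, Exp. III §1.5.4] -/
theorem line_mem_coeffFilTensor {j : ℤ} {x : (Fin n → E) ⊗[P] 𝔅.B}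
    (hx : x ∈ 𝔅.coeffFilTensor E (Fin n → E) j) (i : Fin n) :
    κ i x ∈ 𝔅.coeffFilTensor E (Fin 1 → E) j := by
  refine 𝔅.coeffFilTensor_induction (E := E) (M := Fin n → E)
    (C := fun x => κ i x ∈ 𝔅.coeffFilTensor E (Fin 1 → E) j) ?_ (fun v b hb => ?_)
    (fun y z hy hz => ?_) hx
  · rw [map_zero]; exact zero_mem _
  · rw [hκ]; exact 𝔅.tmul_mem_coeffFilTensor _ hb
  · rw [map_add]; exact add_mem hy hz

omit [TopologicalSpace Γ] [TopologicalSpace E] [IsTopologicalRing E] in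
include hκ in
/-- `p_τ ∘ κ_i = (piTwist τ ·)_i`: `piTwist τ (κ_i x) 0 = piTwist τ x i`.
[cite: Lang1965Algebra, Ch. XVI §2 (maps on generators of a tensor product)] -/
theorem piTwist_line (τ : F →ₐ[P] E) (x : (Fin n → E) ⊗[P] 𝔅.B) (i : Fin n) :
    𝔅.piTwist τ 1 (κ i x) 0 = 𝔅.piTwist τ n x i := by
  induction x using TensorProduct.induction_on with
  | zero => rw [map_zero, map_zero, map_zero, Pi.zero_apply, Pi.zero_apply]
  | tmul v b => rw [hκ, piTwist_tmul, piTwist_tmul]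
  | add y z hy hz => rw [map_add, map_add, map_add, Pi.add_apply, Pi.add_apply, hy, hz]

variable (rE : FramedRep Γ E n) (σ : Γ)
  (φ : (Fin 1 → E) ⊗[P] 𝔅.B →ₐ[E] (Fin 1 → E) ⊗[P] 𝔅.B)
  (hφ : ∀ (c : Fin 1 → E) (b : 𝔅.B), φ (c ⊗ₜ[P] b) = c ⊗ₜ[P] (σ • b))

include hκ hφ in
/-- **Equivariance of the coordinate lines**: `κ_i(σ · x) = Σ_j rE(σ)_{ij} · σ_R(κ_j x)`, where
`σ · x` is the diagonal action of `rE` on `Eⁿ ⊗ B` and `σ_R = 1 ⊗ σ` the ring automorphism of `E ⊗ B`.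
[cite: FontaineAsterisque223III, Exp. III §1.5 (the diagonal action)] -/
theorem line_coeffTensorRep (x : (Fin n → E) ⊗[P] 𝔅.B) (i : Fin n) :
    κ i (𝔅.coeffTensorRep (FramedRep.toContinuousRep rE) σ x) =
      ∑ j, ((rE σ : GL (Fin n) E) : Matrix (Fin n) (Fin n) E) i j • φ (κ j x) := by
  induction x using TensorProduct.induction_on with
  | zero => simp only [map_zero, smul_zero, Finset.sum_const_zero]
  | tmul v b =>
    rw [coeffTensorRep_apply_tmul, hκ, FramedRep.toContinuousRep_apply_apply]
    simp_rw [hκ, hφ, TensorProduct.smul_tmul', ← TensorProduct.sum_tmul]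
    congr 1
    funext t
    rw [Finset.sum_apply]
    simp only [Pi.smul_apply, smul_eq_mul, Matrix.mulVec, dotProduct]
  | add y z hy hz =>
    rw [map_add, map_add, hy, hz, ← Finset.sum_add_distrib]
    exact Finset.sum_congr rfl fun j _ => by rw [map_add, map_add, smul_add]

include hφ in
/-- **The diagonal action of a character `χ` on `E ⊗ B` is `χ(σ) · σ_R`.**
[cite: FontaineAsterisque223III, Exp. III §1.5 (the diagonal action)] -/
theorem coeffTensorRep_scalar_comp (χ : Γ →ₜ* Eˣ) (y : (Fin 1 → E) ⊗[P] 𝔅.B) :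
    𝔅.coeffTensorRep (FramedRep.toContinuousRep ((FramedRep.scalar E 1).comp χ)) σ y =
      ((χ σ : Eˣ) : E) • φ y := by
  induction y using TensorProduct.induction_on with
  | zero => rw [map_zero, map_zero, smul_zero]
  | tmul c b =>
    rw [coeffTensorRep_apply_tmul, hφ, FramedRep.toContinuousRep_apply_apply, TensorProduct.smul_tmul']
    congr 1
    show Matrix.mulVec ((FramedRep.scalar E 1 (χ σ) : GL (Fin 1) E) : Matrix (Fin 1) (Fin 1) E) c = _
    rw [FramedRep.coe_scalar_apply, Algebra.algebraMap_eq_smul_one, Matrix.smul_mulVec,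
      Matrix.one_mulVec]
  | add y z hy hz => rw [map_add, map_add, hy, hz, smul_add]

end Lines

/-! ### The period determinant `δ ∈ D_τ(det rE)` -/

section Determinant

variable {Γ : Type u} [Group Γ] [TopologicalSpace Γ] {P : Type v} {F : Type v'} [Field P] [Field F]
  [Algebra P F] [TopologicalSpace P] {E : Type w} [Field E] [Algebra P E] [TopologicalSpace E]
  [IsTopologicalRing E] (𝔅 : PeriodRingData.{u, v, v', w'} Γ P F) (τ : F →ₐ[P] E) {n : ℕ}
  (rE : FramedRep Γ E n)

/-- **The period determinant.**  For `rE : Γ → GL_n(E)` satisfying the filtered comparison (`hcomp`)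
and an adapted basis `(d_k)_{k<n}` of `D_τ(rE)` with weights `h_k`, there is
`δ ∈ Fil^{Σ h_k} D_τ(det rE)` with `δ ∉ Eⁿ ⊗ Fil^{Σ h_k + 1} B` — namely
`δ = det(κ_i d_k) · x_τ`, see the module docstring.
[cite: Patrikis2019, §2.3.1] [cite: FontaineAsterisque223III, Exp. III Thm. 1.5.2 and Prop. 1.5.2] [cite: Wach1996, §B.2.3, proof of Prop. 2 (p. 394)] -/
theorem exists_mem_labelFilD_scalar_comp_det [FiniteDimensional P F] [Algebra.IsSeparable P F]
    (hsplit : Fintype.card (F →ₐ[P] E) = Module.finrank P F)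
    (hcomp : ∃ (ℓ : ℕ) (𝒷 : Module.Basis (Fin ℓ) 𝔅.B (𝔅.B ⊗[P] (Fin n → E))) (w : Fin ℓ → ℤ),
      (∀ l, 𝒷 l ∈ 𝔅.D ((FramedRep.toContinuousRep rE).restrictScalars P)) ∧
      (∀ l, 𝒷 l ∈ 𝔅.filTensor (Fin n → E) (w l)) ∧
      ∀ (j : ℤ) (y : 𝔅.B ⊗[P] (Fin n → E)),
        y ∈ 𝔅.filTensor (Fin n → E) j ↔ ∀ l, 𝒷.repr y l ∈ 𝔅.fil (j - w l))
    (d : Module.Basis (Fin n) E (𝔅.labelD (FramedRep.toContinuousRep rE) τ.toRingHom))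
    (h : Fin n → ℤ)
    (hdh : ∀ k, (d k : (Fin n → E) ⊗[P] 𝔅.B) ∈
      𝔅.labelFilD (FramedRep.toContinuousRep rE) τ.toRingHom (h k))
    (hiff : ∀ (i : ℤ) (v : 𝔅.labelD (FramedRep.toContinuousRep rE) τ.toRingHom),
      (v : (Fin n → E) ⊗[P] 𝔅.B) ∈ 𝔅.labelFilD (FramedRep.toContinuousRep rE) τ.toRingHom i ↔
        ∀ k, d.repr v k ≠ 0 → i ≤ h k) :
    ∃ δ : (Fin 1 → E) ⊗[P] 𝔅.B,
      δ ∈ 𝔅.labelFilD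
          (FramedRep.toContinuousRep ((FramedRep.scalar E 1).comp (FramedRep.det rE)))
          τ.toRingHom (∑ k, h k) ∧
      δ ∉ 𝔅.coeffFilTensor E (Fin 1 → E) (∑ k, h k + 1) := by
  classical
  set ρ₁ := FramedRep.toContinuousRep ((FramedRep.scalar E 1).comp (FramedRep.det rE)) with hρ₁
  set ρ₀ := FramedRep.toContinuousRep ((FramedRep.scalar E 1).comp (1 : Γ →ₜ* Eˣ)) with hρ₀
  -- coordinate lines
  let κ : Fin n → ((Fin n → E) ⊗[P] 𝔅.B →ₗ[E] (Fin 1 → E) ⊗[P] 𝔅.B) := fun j =>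
    TensorProduct.AlgebraTensorModule.map
      (LinearMap.pi fun _ : Fin 1 => (LinearMap.proj j : (Fin n → E) →ₗ[E] E))
      (LinearMap.id : 𝔅.B →ₗ[P] 𝔅.B)
  have hκ : ∀ (j : Fin n) (v : Fin n → E) (b : 𝔅.B),
      κ j (v ⊗ₜ[P] b) = (fun _ : Fin 1 => v j) ⊗ₜ[P] b := fun j v b => rfl
  -- the ring automorphisms `σ_R = 1 ⊗ σ`
  let φ : Γ → ((Fin 1 → E) ⊗[P] 𝔅.B →ₐ[E] (Fin 1 → E) ⊗[P] 𝔅.B) := fun σ =>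
    Algebra.TensorProduct.map (AlgHom.id E (Fin 1 → E)) (MulSemiringAction.toAlgHom P 𝔅.B σ)
  have hφ : ∀ (σ : Γ) (c : Fin 1 → E) (b : 𝔅.B), φ σ (c ⊗ₜ[P] b) = c ⊗ₜ[P] (σ • b) :=
    fun σ c b => by
    simp only [φ, Algebra.TensorProduct.map_tmul, AlgHom.coe_id, id_eq,
      MulSemiringAction.toAlgHom_apply]
  -- the projection `p : R → T`
  obtain ⟨p, hp⟩ := 𝔅.exists_ringHom_piTwist_one τ (E := E)
  -- the label component `x_τ` of `1` for the trivial character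
  have h1D : (1 : (Fin 1 → E) ⊗[P] 𝔅.B) ∈ 𝔅.coeffD ρ₀ := by
    rw [mem_coeffD_iff]
    intro σ
    rw [hρ₀, 𝔅.coeffTensorRep_scalar_comp σ (φ σ) (hφ σ), map_one]
    simp only [ContinuousMonoidHom.coe_one, Pi.one_apply, Units.val_one, one_smul]
  obtain ⟨xl, hxl, hxlsum⟩ :=
    𝔅.exists_sum_labelFilD_eq ρ₀ hsplit h1D 𝔅.one_mem_coeffFilTensor_zero
  have hxD : ∀ τ', xl τ' ∈ 𝔅.labelD ρ₀ τ'.toRingHom := fun τ' => (Submodule.mem_inf.1 (hxl τ')).1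
  have hxF : xl τ ∈ 𝔅.coeffFilTensor E (Fin 1 → E) 0 := (Submodule.mem_inf.1 (hxl τ)).2
  have hxeig : ∀ f : F, 𝔅.baseAct E (Fin 1 → E) f (xl τ) = τ f • xl τ :=
    fun f => ((𝔅.mem_labelD_iff ρ₀ _ _).1 (hxD τ)).2 f
  have hφx : ∀ σ, φ σ (xl τ) = xl τ := fun σ => by
    have h1 := (𝔅.mem_coeffD_iff ρ₀ _).1 (𝔅.labelD_le_coeffD ρ₀ _ (hxD τ)) σ
    rw [hρ₀, 𝔅.coeffTensorRep_scalar_comp σ (φ σ) (hφ σ)] at h1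
    simpa only [ContinuousMonoidHom.coe_one, Pi.one_apply, Units.val_one, one_smul] using h1
  have hpx : p (xl τ) = 1 := by
    have h1 : p (∑ τ', xl τ') = 1 := by rw [hxlsum, map_one]
    rw [map_sum, Finset.sum_eq_single τ (fun τ' _ hne => by
      rw [hp, 𝔅.piTwist_eq_zero_of_mem_labelD ρ₀ τ hne (hxD τ'), Pi.zero_apply])
      (fun h => absurd (Finset.mem_univ τ) h)] at h1
    exact h1
  -- the matrix `C_R` and `δ`
  set C : Matrix (Fin n) (Fin n) ((Fin 1 → E) ⊗[P] 𝔅.B) :=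
    Matrix.of fun k i => κ i (d k : (Fin n → E) ⊗[P] 𝔅.B) with hC
  set δ := C.det * xl τ with hδ
  -- filtration degree from below
  have hCF : C.det ∈ 𝔅.coeffFilTensor E (Fin 1 → E) (∑ k, h k) :=
    𝔅.det_mem_coeffFilTensor C h fun k l => by
      rw [hC, Matrix.of_apply]
      exact 𝔅.line_mem_coeffFilTensor κ hκ (Submodule.mem_inf.1 (hdh k)).2 l
  have hδF : δ ∈ 𝔅.coeffFilTensor E (Fin 1 → E) (∑ k, h k) := by
    have h1 := 𝔅.mul_mem_coeffFilTensor E hCF hxF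
    rwa [add_zero] at h1
  -- image in `T`
  have hpC : p C.det =
      (Matrix.of fun k i => 𝔅.piTwist τ n (d k : (Fin n → E) ⊗[P] 𝔅.B) i).det := by
    rw [RingHom.map_det]
    congr 1
    ext k i
    rw [RingHom.mapMatrix_apply, Matrix.map_apply, hC, Matrix.of_apply, Matrix.of_apply, hp,
      𝔅.piTwist_line κ hκ τ]
  have hpδ : p δ = (Matrix.of fun k i => 𝔅.piTwist τ n (d k : (Fin n → E) ⊗[P] 𝔅.B) i).det := by
    rw [hδ, map_mul, hpC, hpx, mul_one]
  have hnot : δ ∉ 𝔅.coeffFilTensor E (Fin 1 → E) (∑ k, h k + 1) := fun hmem => by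
    have h1 := 𝔅.piTwist_apply_mem_twistFil τ hmem 0
    rw [← hp, hpδ] at h1
    exact (𝔅.isUnit_det_piTwist_and_mem τ (FramedRep.toContinuousRep rE) hsplit hcomp d h hdh
      hiff).2.2 h1
  -- equivariance: `C = σ_R(C) · ᵗ(rE σ)`
  have hCeq : ∀ σ, C = C.map (φ σ) *
      ((((rE σ : GL (Fin n) E) : Matrix (Fin n) (Fin n) E)).map
        (algebraMap E ((Fin 1 → E) ⊗[P] 𝔅.B))).transpose := fun σ => by
    ext k i
    have hinv : 𝔅.coeffTensorRep (FramedRep.toContinuousRep rE) σ (d k : (Fin n → E) ⊗[P] 𝔅.B) =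
        d k :=
      (𝔅.mem_coeffD_iff (FramedRep.toContinuousRep rE) _).1
        (𝔅.labelD_le_coeffD (FramedRep.toContinuousRep rE) _ (d k).2) σ
    have h1 := 𝔅.line_coeffTensorRep κ hκ rE σ (φ σ) (hφ σ) (d k : (Fin n → E) ⊗[P] 𝔅.B) i
    rw [hinv] at h1
    rw [Matrix.mul_apply, hC, Matrix.of_apply, h1]
    refine Finset.sum_congr rfl fun j _ => ?_
    rw [Matrix.map_apply, Matrix.transpose_apply, Matrix.map_apply, Matrix.of_apply,
      Algebra.smul_def, mul_comm]
  have hdetC : ∀ σ, C.det = φ σ C.det *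
      algebraMap E ((Fin 1 → E) ⊗[P] 𝔅.B)
        (((rE σ : GL (Fin n) E) : Matrix (Fin n) (Fin n) E)).det := fun σ => by
    conv_lhs => rw [hCeq σ]
    rw [Matrix.det_mul, Matrix.det_transpose, AlgHom.map_det, AlgHom.mapMatrix_apply,
      RingHom.map_det, RingHom.mapMatrix_apply]
  have hδD : δ ∈ 𝔅.coeffD ρ₁ := by
    rw [mem_coeffD_iff]
    intro σ
    rw [hρ₁, 𝔅.coeffTensorRep_scalar_comp σ (φ σ) (hφ σ), hδ, map_mul, hφx σ,
      FramedRep.det_apply, Matrix.GeneralLinearGroup.val_det_apply, Algebra.smul_def, ← mul_assoc,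
      mul_comm (algebraMap E ((Fin 1 → E) ⊗[P] 𝔅.B) _), ← hdetC σ]
  have heig : ∀ f : F, 𝔅.baseAct E (Fin 1 → E) f δ = τ f • δ := fun f => by
    rw [hδ, 𝔅.baseAct_mul, hxeig f, mul_smul_comm]
  exact ⟨δ, Submodule.mem_inf.2 ⟨(𝔅.mem_labelD_iff ρ₁ _ _).2 ⟨hδD, heig⟩, hδF⟩, hnot⟩

end Determinant

/-! ### Assembly: the labelled weights of a line, and of `det rE` -/

section Assembly

variable {Γ : Type u} [Group Γ] [TopologicalSpace Γ] {P : Type v} {F : Type v'} [Field P] [Field F]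
  [Algebra P F] [TopologicalSpace P] {E : Type w} [Field E] [Algebra P E] [TopologicalSpace E]
  [IsTopologicalRing E] (𝔅 : PeriodRingData.{u, v, v', w'} Γ P F)

omit [IsTopologicalRing E] in
/-- **The labelled weights of a line.**  Let `ρ₀ : Γ → GL_1(E)` (`E/P` finite containing the `[F:P]`
embeddings of `F`) have a nonzero `τ'`-eigenvector in `D(ρ₀)` for every label `τ'`; then every
`D_{τ'}(ρ₀)` is a line (Fontaine's count `dim_E D(ρ₀) ≤ [F:P]`), and if `x ∈ D_τ(ρ₀)` lies in
`E ⊗ Fil^w B` but not in `E ⊗ Fil^{w+1} B`, then **`HT_τ(ρ₀) = {w}`**.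
[cite: Patrikis2019, §2.3.1] [cite: FontaineAsterisque223III, Exp. III Prop. 1.4.2 and Thm. 1.5.2] -/
theorem labelledHodgeTateWeights_eq_singleton [FiniteDimensional P F] [Algebra.IsSeparable P F]
    [FiniteDimensional P E] (hsplit : Fintype.card (F →ₐ[P] E) = Module.finrank P F)
    (ρ₀ : ContinuousRep Γ E (Fin 1 → E))
    (hex : ∀ τ' : F →ₐ[P] E, ∃ x ∈ 𝔅.labelD ρ₀ τ'.toRingHom, x ≠ 0)
    (τ : F →ₐ[P] E) {w : ℤ} {x : (Fin 1 → E) ⊗[P] 𝔅.B} (hxD : x ∈ 𝔅.labelD ρ₀ τ.toRingHom)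
    (hxw : x ∈ 𝔅.coeffFilTensor E (Fin 1 → E) w)
    (hxw' : x ∉ 𝔅.coeffFilTensor E (Fin 1 → E) (w + 1)) :
    𝔅.labelledHodgeTateWeights ρ₀ τ.toRingHom = {w} := by
  classical
  -- finiteness and Fontaine's count `dim_E D(ρ₀) ≤ [F:P]`
  haveI : Module.Finite F (𝔅.D (ρ₀.restrictScalars P)) :=
    Module.rank_lt_aleph0_iff.1 ((𝔅.rank_D_le _).trans_lt Cardinal.natCast_lt_aleph0)
  have hD : Module.finrank F (𝔅.D (ρ₀.restrictScalars P)) ≤ Module.finrank P (Fin 1 → E) :=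
    𝔅.finrank_D_le_holds _
  obtain ⟨hfin, hle⟩ := 𝔅.finite_coeffD_and_finrank_le ρ₀ hD
  haveI := hfin
  haveI : ∀ τ' : F →ₐ[P] E, FiniteDimensional E (𝔅.labelD ρ₀ τ'.toRingHom) := fun τ' =>
    Submodule.finiteDimensional_of_le (𝔅.labelD_le_coeffD ρ₀ _)
  have hsum : Module.finrank E (𝔅.coeffD ρ₀) =
      ∑ τ' : F →ₐ[P] E, Module.finrank E (𝔅.labelD ρ₀ τ'.toRingHom) := by
    rw [CoeffEigen.finrank_eq_sum_finrank_eigenSub (U := 𝔅.coeffD ρ₀) (𝔅.coeffDAct ρ₀) hsplit]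
    exact Finset.sum_congr rfl fun τ' _ => 𝔅.finrank_eigenSub_coeffDAct ρ₀ τ'
  have hge : ∀ τ' : F →ₐ[P] E, 1 ≤ Module.finrank E (𝔅.labelD ρ₀ τ'.toRingHom) := fun τ' => by
    obtain ⟨y, hy, hy0⟩ := hex τ'
    exact Module.finrank_pos_iff_exists_ne_zero.2 ⟨⟨y, hy⟩, fun h => hy0 (congrArg Subtype.val h)⟩
  have h1 : Module.finrank E (𝔅.labelD ρ₀ τ.toRingHom) = 1 := by
    refine CoeffEigen.eq_of_sum_le_of_le
      (d := fun τ' : F →ₐ[P] E => Module.finrank E (𝔅.labelD ρ₀ τ'.toRingHom)) ?_ hge τ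
    rw [← hsum, hsplit]
    exact hle
  have hx0 : x ≠ 0 := fun h0 => hxw' (by rw [h0]; exact zero_mem _)
  -- the filtration of the line `D_τ` has one jump, at `w`
  have hfun : (fun i => Module.finrank E (𝔅.labelFilD ρ₀ τ.toRingHom i)) =
      fun i => if i ≤ w then 1 else 0 := by
    funext i
    rw [𝔅.finrank_labelFilD_eq_ite_of_finrank_eq_one ρ₀ τ.toRingHom h1 hxD hx0 i]
    by_cases hi : i ≤ w
    · rw [if_pos hi, if_pos (𝔅.coeffFilTensor_antitone E (Fin 1 → E) hi hxw)]
    · rw [if_neg hi, if_neg (fun hmem => hxw'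
        (𝔅.coeffFilTensor_antitone E (Fin 1 → E) (show w + 1 ≤ i by omega) hmem))]
  rw [labelledHodgeTateWeights_def, hfun, jumpMultiset_step, Multiset.replicate_one]

/-- **Labelled Hodge–Tate weights of the determinant: `HT_τ(det rE) = {Σ HT_τ(rE)}`.**  For a
period-ring datum whose period ring is a field, `E/P` finite containing the `[F:P]` embeddings of `F`,
and `rE : Γ → GL_n(E)` `B`-admissible satisfying the filtered comparison (`hcomp`; for `B_dR` and
`rE` de Rham this is the accepted `exists_basis_mem_filTensor_iff_of_isDeRham`), the labelled
Hodge–Tate weights of the character `det rE` (as the framed representation `scalar ∘ det rE`) at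
every label `τ` form the singleton `{Σ_k HT_τ(rE)_k}`.
[cite: Patrikis2019, §2.3.1] [cite: FontaineAsterisque223III, Exp. III Thm. 1.5.2 and Prop. 1.5.2] -/
theorem labelledHodgeTateWeights_scalar_comp_det (hB : IsField 𝔅.B) [FiniteDimensional P F]
    [Algebra.IsSeparable P F] [FiniteDimensional P E]
    (hsplit : Fintype.card (F →ₐ[P] E) = Module.finrank P F) {n : ℕ} (rE : FramedRep Γ E n)
    (hadm : 𝔅.IsAdmissible ((FramedRep.toContinuousRep rE).restrictScalars P))
    (hcomp : ∃ (ℓ : ℕ) (𝒷 : Module.Basis (Fin ℓ) 𝔅.B (𝔅.B ⊗[P] (Fin n → E))) (w : Fin ℓ → ℤ),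
      (∀ l, 𝒷 l ∈ 𝔅.D ((FramedRep.toContinuousRep rE).restrictScalars P)) ∧
      (∀ l, 𝒷 l ∈ 𝔅.filTensor (Fin n → E) (w l)) ∧
      ∀ (j : ℤ) (y : 𝔅.B ⊗[P] (Fin n → E)),
        y ∈ 𝔅.filTensor (Fin n → E) j ↔ ∀ l, 𝒷.repr y l ∈ 𝔅.fil (j - w l))
    (τ : F →ₐ[P] E) :
    𝔅.labelledHodgeTateWeights
        (FramedRep.toContinuousRep ((FramedRep.scalar E 1).comp (FramedRep.det rE))) τ.toRingHom =
      {(𝔅.labelledHodgeTateWeights (FramedRep.toContinuousRep rE) τ.toRingHom).sum} := by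
  classical
  -- adapted bases of every `D_{τ'}(rE)`, indexed by `Fin n`
  have hbasis : ∀ τ' : F →ₐ[P] E,
      ∃ (d : Module.Basis (Fin n) E (𝔅.labelD (FramedRep.toContinuousRep rE) τ'.toRingHom))
        (h : Fin n → ℤ),
        (∀ k, (d k : (Fin n → E) ⊗[P] 𝔅.B) ∈
          𝔅.labelFilD (FramedRep.toContinuousRep rE) τ'.toRingHom (h k)) ∧
        ∀ (i : ℤ) (v : 𝔅.labelD (FramedRep.toContinuousRep rE) τ'.toRingHom),
          (v : (Fin n → E) ⊗[P] 𝔅.B) ∈ 𝔅.labelFilD (FramedRep.toContinuousRep rE) τ'.toRingHom i ↔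
            ∀ k, d.repr v k ≠ 0 → i ≤ h k := fun τ' => by
    obtain ⟨hfinτ, hrank⟩ := 𝔅.finrank_labelD_eq_of_isAdmissible hB hsplit rE hadm τ'
    haveI := hfinτ
    obtain ⟨m, d, h, hdh, hiff⟩ :=
      𝔅.exists_basis_labelD_adapted (FramedRep.toContinuousRep rE) τ'.toRingHom
    have hm : m = n := by rw [← hrank, Module.finrank_eq_card_basis d, Fintype.card_fin]
    subst hm
    exact ⟨d, h, hdh, hiff⟩
  -- a nonzero eigenvector of `D(det rE)` in every label
  have hex : ∀ τ' : F →ₐ[P] E, ∃ x ∈ 𝔅.labelD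
      (FramedRep.toContinuousRep ((FramedRep.scalar E 1).comp (FramedRep.det rE))) τ'.toRingHom,
      x ≠ 0 := fun τ' => by
    obtain ⟨d, h, hdh, hiff⟩ := hbasis τ'
    obtain ⟨δ, hδ, hδnot⟩ :=
      𝔅.exists_mem_labelFilD_scalar_comp_det τ' rE hsplit hcomp d h hdh hiff
    exact ⟨δ, 𝔅.labelFilD_le _ _ _ hδ, fun h0 => hδnot (by rw [h0]; exact zero_mem _)⟩
  obtain ⟨d, h, hdh, hiff⟩ := hbasis τ
  obtain ⟨δ, hδ, hδnot⟩ := 𝔅.exists_mem_labelFilD_scalar_comp_det τ rE hsplit hcomp d h hdh hiff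
  rw [sum_labelledHodgeTateWeights_eq d h hiff]
  exact 𝔅.labelledHodgeTateWeights_eq_singleton hsplit _ hex τ (𝔅.labelFilD_le _ _ _ hδ)
    (Submodule.mem_inf.1 hδ).2 hδnot

end Assembly

end PeriodRingData

end Literature.NumberTheory.GaloisRepresentations

end
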